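import Literature.AlgebraicGeometry.ModuliOfAbelianVarieties.SiegelAdmissibleOfLevelReading
import Literature.AlgebraicGeometry.ModuliOfAbelianVarieties.SiegelAdelicCongrTransport
import Literature.AlgebraicGeometry.ModuliOfAbelianVarieties.SiegelAdelicMarkingPrincipalTransport
import Literature.AlgebraicGeometry.AbelianSchemes.AbelianSchemeOverRestrictPt
import HarnessLib

/-!
# (β3) LEVEL HALF — the level sections of the Hecke isogeny quotient read through the moved marking at `r`
# ([Milne 2005] Thm. 6.11 «`ηK ↦ a K`»; [MFK94] Def. 7.1; [Lan 2013] Def. 1.3.6.2)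

Topic `AlgebraicGeometry/ModuliOfAbelianVarieties`; namespace `Literature.AlgebraicGeometry.ModuliOfAbelianVarieties`.
KERNEL ONLY: theorems; no definition, no named fact, no instance, no `sorry`.

Cell hodgecm-mathlib, line card HECKE-LINK v1.1, socket (B) = B4, sub-brick (β3) `QuotientReadings` of B-p14 (g14)'s
`BetaSockets.v1` (f6fb2461), LEVEL half.  SETTING: `A′ → B` a homomorphism `ψ` of complex abelian varieties; `A′` marked by
`[J(Z), r′]` (`m`), `B` marked by `[J(Z′), r]` (`m_B`) with `u_B(v) = ψ(u(γ⁻¹v))` ((β1)); a symplectic lift `Λ′` of a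
level-`N′` structure `η′` of (an abelian scheme with identity fibre) `A′` reading `u` through `r′`; the target's level-`N`
sections are `ψ(η′ᵢ ^ d)` (`N′ = N·d`, H3 (T3) shape); the link's lattice clauses (QA4) `(γ − 1)Λ_r ⊆ N•Λ_r` and (QA5)
`r′ = r·k`, `k ∈ K_δ(N)`.  CONCLUSION (`hlevel` of ★ `isAdmissibleAt_of_levelReading` for the target):
every target section reads through `r` via `m_B` at the class `eᵢ/N` — with the EXPLICIT vector `v := γ (d • vᵢ′)` where
`r′⁻¹ v̂ᵢ′ ≡ eᵢ/N′`.

* (private `single_one_val_div`) · `adelicCongr_single_level_div` — `r′⁻¹ v̂ ≡ eᵢ/N′ ⇒ r′⁻¹ (d•v)^ ≡ eᵢ/N` (`N′ = N d`).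
* `adelicCongr_of_eq_mul_principalLevelSubgroup` — change of representative `r′ = r k`, `k ∈ K_δ(N)`, at level `N`.
* `adelicCongr_mulVec_of_cong_one_mod` — (QA4) moves `w ↦ γ w` inside a level-`N` reading at `r`.
* `quotient_levelReading` — the `hlevel` clause for the quotient.

## References
* [Milne2005ShimuraVarieties] J. S. Milne, Introduction to Shimura varieties (2005), §6 Thm. 6.11 pp. 74–75.
* [MumfordFogartyKirwan1994] Ch. 7 §1 Def. 7.1 (p. 129).
* [Lan2013PELCompactifications] Def. 1.3.6.2 (p. 80).
HC_CM is proved only modulo the 7 printed citations until rung 0 closes; this file discharges none of them.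
-/

set_option autoImplicit false

noncomputable section

open CategoryTheory AlgebraicGeometry Matrix
open Literature.AlgebraicGeometry.Motives (SchemeOver ComplexPoints AlgPoints specOver AbelianVariety CartierDivisor)
open Literature.AlgebraicGeometry.AbelianSchemes (AbelianSchemeOver)
open Literature.NumberTheory.Automorphic (siegelUpperHalfSpace)
open Literature.NumberTheory.Adeles (latticeOfGL latticeOfGL_mul_eq_of_mem)

namespace Literature.AlgebraicGeometry.ModuliOfAbelianVarieties

open SiegelModuli
open scoped MonObj

variable {g : ℕ} {δ : Fin g → ℕ}

/-! ## Three adelic bookkeeping lemmas -/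

/-- The class vector of `eᵢ` at level `n`: `((Pi.single i 1 : _ → ZMod n) j).val / n = if j = i then 1/n else 0` for
`1 < n` (private helper). [folklore] -/
private theorem single_one_val_div (n : ℕ) (hn : 1 < n) (i j : Fin g ⊕ Fin g) :
    ((((Pi.single i (1 : ZMod n) : Fin g ⊕ Fin g → ZMod n) j).val : ℚ) / n) =
      if j = i then (1 : ℚ) / n else 0 := by
  haveI : Fact (1 < n) := ⟨hn⟩
  by_cases h : j = i
  · subst h; simp [ZMod.val_one]
  · simp [h]

/-- **Level division**: if `r′⁻¹ v̂ ≡ eᵢ/N′ (mod ℤ̂)` and `N′ = N·d`, then `r′⁻¹ (d•v)^ ≡ eᵢ/N`.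
[cite: Milne2005ShimuraVarieties, §6 Thm. 6.11 p. 74 and p. 75] -/
theorem adelicCongr_single_level_div {N N' d : ℕ} (hN : 1 < N) (hd : N' = N * d) (hd0 : d ≠ 0)
    (b : GL (Fin g ⊕ Fin g) finAdeleQ) (i : Fin g ⊕ Fin g) {v : Fin g ⊕ Fin g → ℚ}
    (hv : AdelicCongr b 1 v (fun j => (((Pi.single i (1 : ZMod N') : Fin g ⊕ Fin g → ZMod N') j).val : ℚ) / N')) :
    AdelicCongr b 1 (d • v) (fun j => (((Pi.single i (1 : ZMod N) : Fin g ⊕ Fin g → ZMod N) j).val : ℚ) / N) := by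
  have hN' : 1 < N' := by
    rw [hd]; exact lt_of_lt_of_le hN (Nat.le_mul_of_pos_right N (Nat.pos_of_ne_zero hd0))
  have h := hv.nsmul d
  have heq : (d • fun j => (((Pi.single i (1 : ZMod N') : Fin g ⊕ Fin g → ZMod N') j).val : ℚ) / N') =
      fun j => (((Pi.single i (1 : ZMod N) : Fin g ⊕ Fin g → ZMod N) j).val : ℚ) / N := by
    funext j
    rw [Pi.smul_apply, single_one_val_div N' hN' i j, single_one_val_div N hN i j]
    have hdq : (d : ℚ) ≠ 0 := Nat.cast_ne_zero.2 hd0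
    split_ifs
    · rw [hd, Nat.cast_mul, nsmul_eq_mul]; field_simp
    · rw [nsmul_zero]
  rwa [heq] at h

/-- **Change of representative at level `N`**: if `r′ = r·k` with `k ∈ K_δ(N)` and `N•w ∈ Λ_r`, then a reading
`r′⁻¹ ŵ ≡ c` is the same as `r⁻¹ ŵ ≡ c` (★ `adelicCongr_coe_mul_inv_iff_of_mem_principalLevelSubgroup`).
[cite: Milne2005ShimuraVarieties, §6 Thm. 6.11 p. 74 and p. 75] -/
theorem adelicCongr_of_eq_mul_principalLevelSubgroup {N : ℕ} {r r' k : gspFinAdelic δ}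
    (hk : k ∈ principalLevelSubgroup δ N) (hr : r' = r * k) {w c : Fin g ⊕ Fin g → ℚ}
    (hw : N • w ∈ latticeOfGL (r : GL (Fin g ⊕ Fin g) finAdeleQ))
    (h : AdelicCongr ((r'⁻¹ : gspFinAdelic δ) : GL (Fin g ⊕ Fin g) finAdeleQ) 1 w c) :
    AdelicCongr ((r⁻¹ : gspFinAdelic δ) : GL (Fin g ⊕ Fin g) finAdeleQ) 1 w c := by
  have hr' : r'⁻¹ = k⁻¹ * r⁻¹ := by rw [hr, _root_.mul_inv_rev]
  rw [hr'] at h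
  exact (adelicCongr_coe_mul_inv_iff_of_mem_principalLevelSubgroup (inv_mem hk) hw).1 h

/-- **(QA4) inside a reading**: if `(γ − 1)Λ_r ⊆ N•Λ_r`, `N ≠ 0`, `N•w ∈ Λ_r` and `r⁻¹ ŵ ≡ c`, then `r⁻¹ (γw)^ ≡ c`
(`γw − w = (1/N)(γ − 1)(Nw) ∈ Λ_r`, ★ `AdelicCongr.of_sub_mem_latticeOfGL_left`).
[cite: Milne2005ShimuraVarieties, §6 Thm. 6.11 p. 74 and p. 75] -/
theorem adelicCongr_mulVec_of_cong_one_mod {N : ℕ} (hN : N ≠ 0) {r : gspFinAdelic δ} (γq : GL (Fin g ⊕ Fin g) ℚ)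
    (hQA4 : ∀ w : Fin g ⊕ Fin g → ℚ, w ∈ latticeOfGL (r : GL (Fin g ⊕ Fin g) finAdeleQ) →
      ∃ w' : Fin g ⊕ Fin g → ℚ, w' ∈ latticeOfGL (r : GL (Fin g ⊕ Fin g) finAdeleQ) ∧
        (γq : Matrix (Fin g ⊕ Fin g) (Fin g ⊕ Fin g) ℚ) *ᵥ w - w = (N : ℚ) • w')
    {w c : Fin g ⊕ Fin g → ℚ} (hw : N • w ∈ latticeOfGL (r : GL (Fin g ⊕ Fin g) finAdeleQ))
    (h : AdelicCongr ((r⁻¹ : gspFinAdelic δ) : GL (Fin g ⊕ Fin g) finAdeleQ) 1 w c) :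
    AdelicCongr ((r⁻¹ : gspFinAdelic δ) : GL (Fin g ⊕ Fin g) finAdeleQ) 1
      ((γq : Matrix (Fin g ⊕ Fin g) (Fin g ⊕ Fin g) ℚ) *ᵥ w) c := by
  obtain ⟨w', hw', hww'⟩ := hQA4 (N • w) hw
  have hNq : (N : ℚ) ≠ 0 := Nat.cast_ne_zero.2 hN
  have hsub : (γq : Matrix (Fin g ⊕ Fin g) (Fin g ⊕ Fin g) ℚ) *ᵥ w - w = w' := by
    have h1 : (γq : Matrix (Fin g ⊕ Fin g) (Fin g ⊕ Fin g) ℚ) *ᵥ (N • w) - N • w =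
        (N : ℚ) • ((γq : Matrix (Fin g ⊕ Fin g) (Fin g ⊕ Fin g) ℚ) *ᵥ w - w) := by
      rw [← Nat.cast_smul_eq_nsmul ℚ N w, Matrix.mulVec_smul, smul_sub]
    rw [h1] at hww'
    exact smul_right_injective _ hNq hww'
  refine h.of_sub_mem_latticeOfGL_left ?_
  rw [hsub, latticeOfGL_inv_coe_inv_eq]
  exact hw'

/-! ## The level reading of the quotient -/

/-- **(β3, level half) «the quotient's level sections read through `r`»**: in the setting of the module docstring, for
every `i` the vector `v := γ (d • vᵢ′)` (where `r′⁻¹ v̂ᵢ′ ≡ eᵢ/N′`) satisfies `r⁻¹ v̂ ≡ eᵢ/N` and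
`σ^B_i(𝟙) = u_B(v)`: `σ^B_i(𝟙) = ψ(η′ᵢ(𝟙)^d) = ψ(u(vᵢ′)^d) = ψ(u(d•vᵢ′)) = u_B(γ(d•vᵢ′))`, and the congruence by
`adelicCongr_single_level_div`, `adelicCongr_of_eq_mul_principalLevelSubgroup` (QA5) and
`adelicCongr_mulVec_of_cong_one_mod` (QA4).  This is the `hlevel` input of ★ `isAdmissibleAt_of_levelReading` for the
Hecke isogeny quotient. [cite: Milne2005ShimuraVarieties, §6 Thm. 6.11 p. 74 and p. 75]
[cite: Lan2013PELCompactifications, §1.3.6 Def. 1.3.6.2 (p. 80)] -/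
theorem quotient_levelReading {N N' d : ℕ} (hδ : IsPolarizationType δ) (hN : 1 < N) (hd : N' = N * d) (hd0 : d ≠ 0)
    (Z : Matrix (Fin g) (Fin g) ℂ) (hZ : Z ∈ siegelUpperHalfSpace g)
    (Z' : Matrix (Fin g) (Fin g) ℂ) (hZ' : Z' ∈ siegelUpperHalfSpace g)
    (r r' : gspFinAdelic δ) (γq : GL (Fin g ⊕ Fin g) ℚ)
    (hQA4 : ∀ w : Fin g ⊕ Fin g → ℚ, w ∈ latticeOfGL (r : GL (Fin g ⊕ Fin g) finAdeleQ) →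
      ∃ w' : Fin g ⊕ Fin g → ℚ, w' ∈ latticeOfGL (r : GL (Fin g ⊕ Fin g) finAdeleQ) ∧
        (γq : Matrix (Fin g ⊕ Fin g) (Fin g ⊕ Fin g) ℚ) *ᵥ w - w = (N : ℚ) • w')
    (hQA5 : ∃ k : gspFinAdelic δ, k ∈ principalLevelSubgroup δ N ∧ r' = r * k)
    {A' : AbelianSchemeOver (specOver ℚ ℂ).left} (η' : A'.LevelStructure g N') (B : AbelianVariety ℂ)
    (ψ : (A'.fibre (𝟙 (Spec (CommRingCat.of ℂ)))).toAbelianVariety ⟶ B)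
    (m : SiegelAdelicMarking ⟨jOfSiegel δ Z, SiegelComplexRecordSystem.jOfSiegel_mem_C0pm hδ.1 hZ⟩ r'
      (A'.fibre (𝟙 (Spec (CommRingCat.of ℂ)))).toAbelianVariety)
    (mB : SiegelAdelicMarking ⟨jOfSiegel δ Z', SiegelComplexRecordSystem.jOfSiegel_mem_C0pm hδ.1 hZ'⟩ r B)
    (hmB : ∀ v : Fin g ⊕ Fin g → ℚ, mB.r v = AlgPoints.map ψ.hom.hom.hom
        (m.r ((((γq⁻¹ : GL (Fin g ⊕ Fin g) ℚ) : Matrix (Fin g ⊕ Fin g) (Fin g ⊕ Fin g) ℚ)) *ᵥ v)))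
    (Θ' : CartierDivisor (A'.fibre (𝟙 (Spec (CommRingCat.of ℂ)))).toAbelianVariety.X.left)
    (Λ' : η'.SymplecticLift (𝟙 (Spec (CommRingCat.of ℂ))) Θ' δ)
    (hΛ' : ∀ ⦃M : ℕ⦄, N' ∣ M → M ≠ 0 → ∀ (x : Fin g ⊕ Fin g → ZMod M) (v : Fin g ⊕ Fin g → ℚ),
        AdelicCongr ((r'⁻¹ : gspFinAdelic δ) : GL (Fin g ⊕ Fin g) finAdeleQ) 1 v (fun i => ((x i).val : ℚ) / M) →
          ((Λ'.lift M (Multiplicative.ofAdd x)) : (A'.fibre (𝟙 (Spec (CommRingCat.of ℂ)))).toAbelianVariety.Points ℂ)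
            = m.r v)
    (σB : Fin g ⊕ Fin g → B.Points ℂ)
    (hlev : ∀ i : Fin g ⊕ Fin g, σB i =
        AlgPoints.map ψ.hom.hom.hom (A'.restrictPt (𝟙 (Spec (CommRingCat.of ℂ))) (η'.σ i ^ d))) :
    ∀ i : Fin g ⊕ Fin g, ∃ v : Fin g ⊕ Fin g → ℚ,
      AdelicCongr ((r⁻¹ : gspFinAdelic δ) : GL (Fin g ⊕ Fin g) finAdeleQ) 1 v
          (fun j => (((Pi.single i (1 : ZMod N) : Fin g ⊕ Fin g → ZMod N) j).val : ℚ) / N) ∧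
        σB i = mB.r v := by
  obtain ⟨k, hk, hr⟩ := hQA5
  have hN0 : N ≠ 0 := by omega
  have hN'0 : N' ≠ 0 := by rw [hd]; exact Nat.mul_ne_zero hN0 hd0
  intro i
  -- the source vector `vᵢ′` with `r′⁻¹ v̂ᵢ′ ≡ eᵢ/N′`
  obtain ⟨v', hv'⟩ := exists_adelicCongr_left ((r'⁻¹ : gspFinAdelic δ) : GL (Fin g ⊕ Fin g) finAdeleQ) 1
    (fun j => (((Pi.single i (1 : ZMod N') : Fin g ⊕ Fin g → ZMod N') j).val : ℚ) / N')
  -- `N′ • vᵢ′ ∈ Λ_{r′} = Λ_r`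
  have hlat : latticeOfGL (r' : GL (Fin g ⊕ Fin g) finAdeleQ) = latticeOfGL (r : GL (Fin g ⊕ Fin g) finAdeleQ) := by
    rw [hr, Subgroup.coe_mul]
    exact latticeOfGL_mul_eq_of_mem _
      (coe_mem_units_matrix_integralFiniteAdeles_of_mem_principalLevelSubgroup_one
        (principalLevelSubgroup_anti δ (one_dvd N) hk))
  have hNw : N • (d • v') ∈ latticeOfGL (r : GL (Fin g ⊕ Fin g) finAdeleQ) := by
    rw [← mul_nsmul', ← hd, ← hlat]
    exact AdelicCongr.nsmul_mem_latticeOfGL_of_level hN'0 hv'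
  -- the reading of `w := d • vᵢ′` at `r`, then of `γ w`
  have h1 := adelicCongr_single_level_div hN hd hd0 _ i hv'
  have h2 := adelicCongr_of_eq_mul_principalLevelSubgroup hk hr hNw h1
  have h3 := adelicCongr_mulVec_of_cong_one_mod hN0 γq hQA4 hNw h2
  refine ⟨(γq : Matrix (Fin g ⊕ Fin g) (Fin g ⊕ Fin g) ℚ) *ᵥ (d • v'), h3, ?_⟩
  -- the section: `σ^B_i = ψ(η′ᵢ(𝟙)^d) = ψ(u(vᵢ′)^d) = ψ(u(d • vᵢ′)) = u_B(γ (d • vᵢ′))`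
  have hsrc : A'.restrictPt (𝟙 (Spec (CommRingCat.of ℂ))) (η'.σ i) = m.r v' := by
    rw [← Λ'.lift_level i]
    exact hΛ' (dvd_refl N') hN'0 _ v' hv'
  have hinv : (((γq⁻¹ : GL (Fin g ⊕ Fin g) ℚ) : Matrix (Fin g ⊕ Fin g) (Fin g ⊕ Fin g) ℚ)) *ᵥ
      ((γq : Matrix (Fin g ⊕ Fin g) (Fin g ⊕ Fin g) ℚ) *ᵥ (d • v')) = d • v' := by
    rw [Matrix.mulVec_mulVec, ← Units.val_mul, inv_mul_cancel, Units.val_one, Matrix.one_mulVec]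
  rw [hlev i, hmB, hinv, AbelianSchemeOver.restrictPt_pow, hsrc, m.r_nsmul]
  rfl

end Literature.AlgebraicGeometry.ModuliOfAbelianVarieties

end
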